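import Mathlib
import Literature.Analysis.FluidPDE.NormalisedPressureSmooth
import Summits.NavierStokesRegularity.NavierStokesRegularity.Theorems.SymmetryModuliCountFarPastLedgerSliceSource
import Summits.NavierStokesRegularity.NavierStokesRegularity.Theorems.SymmetryModuliCountFarPastLedgerSliceFar
import Summits.NavierStokesRegularity.NavierStokesRegularity.Theorems.SymmetryModuliCountFarPastLedgerSliceHarmonic
import Summits.NavierStokesRegularity.NavierStokesRegularity.Theorems.SymmetryModuliCountFarPastLedgerSliceDecompTools
import HarnessLib

/-!
# Slice pressure, the local identity (crux `FarPastLedger`, line `uloc-gronwall-transplant`)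

Helper file for the lead's stub `stub_fplSlicePressure` of crux stmt-NavierStokesRegularity-14060
(`SymmetryModuliCount.FarPastLedger`). THE CORE STEP of the slice harmonic analysis: let `w` be a
smooth bounded divergence-free field, `q` smooth with bounded gradient and
`Δq = -div((w·∇)w)`, and `η² + ζ² = 1` a smooth partition with `η` supported in `B(x₀,4R)` and
`ζ = 0` on `B(x₀,3R)`, `R ≥ 1`. With the near pressure `p₁ = p̃[η w]` and the far gradient field
`G(x) = ∫ D³Γ∞(x-y)(·, ζw(y), ζw(y)) dy` (`Γ∞ = newtonFar (R/2) R`),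

  `Dq(x) - Dp₁(x) + G(x)` is CONSTANT on `B(x₀, 2R)`        (`fpl_slice_identity`).

Proof: truncate the far field by `g_ρ(y) = θ((y-x₀)/ρ)`; `Q_ρ = p̃[(g_ρζ)w]` has
`DQ_ρ = -∫ D³Γ∞(x-y)(·, g_ρζw, g_ρζw) → -G` on `B(x₀,2R)` (dominated convergence), and
`H_ρ = q - p₁ - Q_ρ` is harmonic on `B(x₀,ρ)` (the quadratic sources of `ηw` and `g_ρζw` add up
to that of `w` where `η² + g_ρ²ζ² = 1`) with `∫_{B_ρ}|H_ρ| = O(ρ⁴)` (`Dq` bounded, `p₁, Q_ρ ∈ L²`),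
so `DH_ρ(x) - DH_ρ(x₀) = O(ρ⁻¹) → 0` by the interior oscillation estimate.
-/

noncomputable section

open MeasureTheory Set Filter Metric Topology
open scoped ContDiff Laplacian

set_option linter.dupNamespace false -- nested layout Summit.<S>.<Sub>, Sub = S (D-0017)

namespace Summit.NavierStokesRegularity.NavierStokesRegularity.Theorems

open Literature.Analysis.FluidPDE

-- nested operator types `E →L[ℝ] E →L[ℝ] E →L[ℝ] ℝ`
set_option maxSynthPendingDepth 3

/-! ### The core identity -/

set_option maxHeartbeats 400000 in -- large assembly proof; insurance against farm variance
/-- **THE LOCAL IDENTITY.** With the data of the module docstring (`w` smooth, divergence free,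
`‖w‖ ≤ M`; `q` smooth, `‖Dq‖ ≤ L`, `Δq = -div((w·∇)w)`; a smooth partition `η² + ζ² = 1` with
`η = 0` off `B(x₀,4R)` and `ζ = 0` on `B(x₀,3R)`, `R ≥ 1`), the covector field
`x ↦ Dq(x) - D(p̃[ηw])(x) + ∫ D³Γ∞(x-y)(·, ζw, ζw) dy` is constant on `B(x₀, 2R)`. -/
theorem fpl_slice_identity
    {w : EuclideanSpace ℝ (Fin 3) → EuclideanSpace ℝ (Fin 3)} (hw : ContDiff ℝ ∞ w)
    (hdiv : VectorCalculus.IsDivFree w) {M : ℝ} (hM : ∀ y, ‖w y‖ ≤ M)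
    {q : EuclideanSpace ℝ (Fin 3) → ℝ} (hq : ContDiff ℝ ∞ q) {L : ℝ} (hL : ∀ x, ‖fderiv ℝ q x‖ ≤ L)
    (hΔq : ∀ x, (Δ q) x = -VectorCalculus.divergence (convect w w) x)
    {x₀ : EuclideanSpace ℝ (Fin 3)} {R : ℝ} (hR : 1 ≤ R)
    {η ζ : EuclideanSpace ℝ (Fin 3) → ℝ} (hη : ContDiff ℝ ∞ η) (hζ : ContDiff ℝ ∞ ζ)
    (h1 : ∀ y, η y ^ 2 + ζ y ^ 2 = 1) (hη0 : ∀ y ∉ ball x₀ (4 * R), η y = 0)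
    (hζ0 : ∀ y ∈ ball x₀ (3 * R), ζ y = 0) {x : EuclideanSpace ℝ (Fin 3)} (hx : x ∈ ball x₀ (2 * R)) :
    fderiv ℝ q x - fderiv ℝ (normalisedPressure fun y => η y • w y) x +
        ∫ y, (evalDiag (ζ y • w y)).comp (fderiv ℝ (fderiv ℝ (fderiv ℝ (newtonFar (R / 2) R))) (x - y)) =
      fderiv ℝ q x₀ - fderiv ℝ (normalisedPressure fun y => η y • w y) x₀ +
        ∫ y, (evalDiag (ζ y • w y)).comp (fderiv ℝ (fderiv ℝ (fderiv ℝ (newtonFar (R / 2) R))) (x₀ - y)) := by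
  -- constants
  obtain ⟨C_K, hCK0, hCK⟩ := fpl_exists_kernel_bound
  obtain ⟨K', hK'0, hK'⟩ := fpl_exists_gradient_osc_harmonic
  obtain ⟨C_N, hCN0, hCN⟩ := fpl_exists_near_sq_integral_le
  set V : ℝ := (volume (ball (0 : EuclideanSpace ℝ (Fin 3)) 1)).toReal with hV
  have hV0 : 0 ≤ V := ENNReal.toReal_nonneg
  have hR0 : 0 < R := by linarith
  have hx₀ : x₀ ∈ ball x₀ (2 * R) := mem_ball_self (by linarith)
  have hM0 : 0 ≤ M := (norm_nonneg _).trans (hM 0)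
  have hM0' : 0 ≤ M ^ 2 := sq_nonneg M
  -- the bump data
  set θ : EuclideanSpace ℝ (Fin 3) → ℝ :=
    ((⟨1, 2, zero_lt_one, one_lt_two⟩ : ContDiffBump (0 : EuclideanSpace ℝ (Fin 3))) :
      EuclideanSpace ℝ (Fin 3) → ℝ) with hθ
  set g : ℝ → EuclideanSpace ℝ (Fin 3) → ℝ := fun ρ y => θ (ρ⁻¹ • (y - x₀)) with hg
  have hgd : ∀ ρ, ContDiff ℝ ∞ (g ρ) := fun ρ => fpl_trunc_contDiff x₀
  have hg1 : ∀ ρ y, |g ρ y| ≤ 1 := fun ρ y => fpl_trunc_abs_le_one x₀ ρ y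
  -- `|η|, |ζ| ≤ 1`
  have hη1 : ∀ y, |η y| ≤ 1 := fun y => by
    have := h1 y; nlinarith [sq_nonneg (ζ y), sq_abs (η y)]
  have hζ1 : ∀ y, |ζ y| ≤ 1 := fun y => by
    have := h1 y; nlinarith [sq_nonneg (η y), sq_abs (ζ y)]
  -- the near field `v₁ = η w` and its pressure `p₁`
  set v₁ : EuclideanSpace ℝ (Fin 3) → EuclideanSpace ℝ (Fin 3) := fun y => η y • w y with hv₁
  have hv₁d : ContDiff ℝ ∞ v₁ := hη.smul hw
  have hv₁c : HasCompactSupport v₁ := by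
    refine HasCompactSupport.intro (isCompact_closedBall x₀ (4 * R)) fun y hy => ?_
    have hy' : y ∉ ball x₀ (4 * R) := fun h => hy (ball_subset_closedBall h)
    simp [hv₁, hη0 y hy']
  set p₁ : EuclideanSpace ℝ (Fin 3) → ℝ := normalisedPressure v₁ with hp₁
  have hp₁d : ContDiff ℝ ∞ p₁ := contDiff_normalisedPressure_of_contDiff_infty hv₁d hv₁c
  -- the far field `u = ζ w`
  set u : EuclideanSpace ℝ (Fin 3) → EuclideanSpace ℝ (Fin 3) := fun y => ζ y • w y with hu
  have huc : Continuous u := hζ.continuous.smul hw.continuous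
  have huM : ∀ y, ‖u y‖ ≤ M := fun y => by
    rw [hu]; dsimp only
    rw [norm_smul, Real.norm_eq_abs]
    calc |ζ y| * ‖w y‖ ≤ 1 * M := mul_le_mul (hζ1 y) (hM y) (norm_nonneg _) zero_le_one
      _ = M := one_mul M
  have hu0 : ∀ y ∈ ball x₀ (3 * R), u y = 0 := fun y hy => by
    simp [hu, hζ0 y hy]
  -- the truncated far fields `v ρ = g_ρ u` and their pressures `Q ρ`
  set v : ℝ → EuclideanSpace ℝ (Fin 3) → EuclideanSpace ℝ (Fin 3) := fun ρ y => (g ρ y * ζ y) • w y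
    with hvdef
  have hv_eq : ∀ ρ y, v ρ y = g ρ y • u y := fun ρ y => by
    simp only [hvdef, hu, smul_smul]
  have hvd : ∀ ρ, ContDiff ℝ ∞ (v ρ) := fun ρ => ((hgd ρ).mul hζ).smul hw
  have hvc : ∀ ρ, 0 < ρ → HasCompactSupport (v ρ) := fun ρ hρ => by
    refine HasCompactSupport.intro (isCompact_closedBall x₀ (2 * ρ)) fun y hy => ?_
    have hy' : y ∉ ball x₀ (2 * ρ) := fun h => hy (ball_subset_closedBall h)
    have : g ρ y = 0 := fpl_trunc_eq_zero hρ hy'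
    simp [hvdef, this]
  have hv0 : ∀ ρ, ∀ y ∈ ball x₀ (3 * R), v ρ y = 0 := fun ρ y hy => by
    rw [hv_eq, hu0 y hy, smul_zero]
  set Q : ℝ → EuclideanSpace ℝ (Fin 3) → ℝ := fun ρ => normalisedPressure (v ρ) with hQ
  have hQd : ∀ ρ, 0 < ρ → ContDiff ℝ ∞ (Q ρ) := fun ρ hρ =>
    contDiff_normalisedPressure_of_contDiff_infty (hvd ρ) (hvc ρ hρ)
  -- far gradient fields
  set T : EuclideanSpace ℝ (Fin 3) → EuclideanSpace ℝ (Fin 3) →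
      (EuclideanSpace ℝ (Fin 3) →L[ℝ] ℝ) := fun z y =>
    (evalDiag (u y)).comp (fderiv ℝ (fderiv ℝ (fderiv ℝ (newtonFar (R / 2) R))) (z - y)) with hT
  set Tρ : ℝ → EuclideanSpace ℝ (Fin 3) → EuclideanSpace ℝ (Fin 3) →
      (EuclideanSpace ℝ (Fin 3) →L[ℝ] ℝ) := fun ρ z y =>
    (evalDiag (v ρ y)).comp (fderiv ℝ (fderiv ℝ (fderiv ℝ (newtonFar (R / 2) R))) (z - y)) with hTρ
  -- `DQ_ρ = -∫ Tρ` on `B(x₀, 2R)`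
  have hDQ : ∀ ρ, 0 < ρ → ∀ z ∈ ball x₀ (2 * R), fderiv ℝ (Q ρ) z = -∫ y, Tρ ρ z y :=
    fun ρ hρ z hz =>
      (fpl_hasFDerivAt_normalisedPressure_far hR (hvd ρ) (hvc ρ hρ) (hv0 ρ) hz).fderiv
  -- `∫ Tρ → ∫ T` on `B(x₀, 2R)`
  have hlim : ∀ z ∈ ball x₀ (2 * R),
      Tendsto (fun ρ => ∫ y, Tρ ρ z y) atTop (𝓝 (∫ y, T z y)) := by
    intro z hz
    have key := fpl_tendsto_farGradient hCK hR huc huM hu0 hz (c := g)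
      (fun ρ => (hgd ρ).continuous) hg1 (fun y => fpl_trunc_eventually_one x₀ y)
    refine (tendsto_congr fun ρ => ?_).2 key
    refine integral_congr_ae (Eventually.of_forall fun y => ?_)
    simp only [hTρ, hv_eq]
  -- the harmonic functions `H ρ = q - p₁ - Q ρ`
  set H : ℝ → EuclideanSpace ℝ (Fin 3) → ℝ := fun ρ => q - p₁ - Q ρ with hH
  have hHd : ∀ ρ, 0 < ρ → ContDiff ℝ 3 (H ρ) := fun ρ hρ =>
    ((hq.sub hp₁d).sub (hQd ρ hρ)).of_le (by norm_cast)
  -- harmonicity on `B(x₀, ρ)` for `ρ ≥ 4R`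
  have hHharm : ∀ ρ, 4 * R ≤ ρ → ∀ y ∈ ball x₀ ρ, (Δ (H ρ)) y = 0 := by
    intro ρ hρ y hy
    have hρ0 : 0 < ρ := by linarith
    have hq2 : ContDiff ℝ 2 q := hq.of_le (by norm_cast)
    have hp2 : ContDiff ℝ 2 p₁ := hp₁d.of_le (by norm_cast)
    have hQ2 : ContDiff ℝ 2 (Q ρ) := (hQd ρ hρ0).of_le (by norm_cast)
    have e1 : (Δ (H ρ)) y = (Δ q) y - (Δ p₁) y - (Δ (Q ρ)) y := by
      have hqp : ContDiff ℝ 2 (q - p₁) := hq2.sub hp2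
      show (Δ (q - p₁ - Q ρ)) y = _
      rw [hqp.contDiffAt.laplacian_sub hQ2.contDiffAt, hq2.contDiffAt.laplacian_sub hp2.contDiffAt]
    rw [e1, hΔq y, hp₁, hQ, laplacian_normalisedPressure_of_hasCompactSupport hv₁d hv₁c,
      laplacian_normalisedPressure_of_hasCompactSupport (hvd ρ) (hvc ρ hρ0)]
    -- the quadratic sources add up
    have hsum : pressureSource v₁ y + pressureSource (v ρ) y = pressureSource w y := by
      have hloc : ∀ᶠ z in 𝓝 y, η z ^ 2 + (g ρ z * ζ z) ^ 2 = 1 := by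
        filter_upwards [isOpen_ball.mem_nhds hy] with z hz
        have : g ρ z = 1 := fpl_trunc_eq_one hρ0 (ball_subset_closedBall hz)
        rw [this, one_mul, h1 z]
      have := fpl_pressureSource_add_of_sq_add_sq_eq_one (v := w) (χ₁ := η)
        (χ₂ := fun z => g ρ z * ζ z) (hη.of_le (by norm_cast))
        (((hgd ρ).mul hζ).of_le (by norm_cast)) (hw.of_le (by norm_cast)) hloc
      simpa only [hv₁, hvdef] using this
    rw [pressureSource_eq_of_isDivFree hdiv] at hsum
    linarith
  -- the `L¹(B_ρ)` bound: `∫_{B(x₀,ρ)} |H ρ| ≤ A ρ⁴ + B ρ³` for `ρ ≥ 4R`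
  obtain ⟨A, B, hA0, hB0, hI⟩ : ∃ A B : ℝ, 0 ≤ A ∧ 0 ≤ B ∧ ∀ ρ, 4 * R ≤ ρ →
      ∫ y in ball x₀ ρ, |H ρ y| ≤ A * ρ ^ 4 + B * ρ ^ 3 := by
    have hL0 : 0 ≤ L := (norm_nonneg _).trans (hL 0)
    -- `∫_{B(c,r)} ‖w‖² ≤ M² r³ V`
    have hwint : ∀ (c : EuclideanSpace ℝ (Fin 3)) (r : ℝ), 0 ≤ r →
        ∫ y in ball c r, ‖w y‖ ^ 2 ≤ M ^ 2 * (r ^ 3 * V) := by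
      intro c r hr
      have hpt : ∀ y, ‖w y‖ ^ 2 ≤ M ^ 2 := fun y =>
        pow_le_pow_left₀ (norm_nonneg _) (hM y) 2
      calc ∫ y in ball c r, ‖w y‖ ^ 2 ≤ ∫ _y in ball c r, M ^ 2 :=
            integral_mono_of_nonneg (Eventually.of_forall fun y => by positivity)
              (integrableOn_const measure_ball_lt_top.ne) (Eventually.of_forall hpt)
        _ = M ^ 2 * (r ^ 3 * V) := by
            rw [setIntegral_const, smul_eq_mul, measureReal_def, fpl_volume_ball_toReal c hr, ← hV,
              mul_comm]
    -- `L²` bounds for `p₁` and `Q ρ`, with `P = 64 C_N M⁴ V`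
    obtain ⟨hp₁mem, hp₁sq⟩ := hCN v₁ hv₁d hv₁c
    set P : ℝ := 64 * C_N * M ^ 4 * V with hPdef
    have hP0 : 0 ≤ P := by positivity
    have hp₁sq' : ∀ ρ, 4 * R ≤ ρ → ∫ y, p₁ y ^ 2 ≤ P * ρ ^ 3 := by
      intro ρ hρ
      refine hp₁sq.trans ?_
      have h4 := fpl_integral_norm_pow_four_le (χ := η) hw.continuous hη1 (c := x₀) (r := 4 * R)
        hη0 hM
      have hR3 : R ^ 3 ≤ ρ ^ 3 := pow_le_pow_left₀ (by linarith) (by linarith) 3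
      calc C_N * ∫ y, ‖v₁ y‖ ^ 4 ≤ C_N * (M ^ 2 * ∫ y in ball x₀ (4 * R), ‖w y‖ ^ 2) :=
            mul_le_mul_of_nonneg_left h4 hCN0
        _ ≤ C_N * (M ^ 2 * (M ^ 2 * ((4 * R) ^ 3 * V))) := by
            gcongr
            exact hwint x₀ (4 * R) (by linarith)
        _ = P * R ^ 3 := by rw [hPdef]; ring
        _ ≤ P * ρ ^ 3 := mul_le_mul_of_nonneg_left hR3 hP0
    have hQsq : ∀ ρ, 0 < ρ → MemLp (Q ρ) 2 volume ∧ ∫ y, Q ρ y ^ 2 ≤ 9 * P * ρ ^ 3 := by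
      intro ρ hρ
      obtain ⟨hmem, hsq⟩ := hCN (v ρ) (hvd ρ) (hvc ρ hρ)
      refine ⟨hmem, hsq.trans ?_⟩
      have hχ1 : ∀ y, |g ρ y * ζ y| ≤ 1 := fun y => by
        rw [abs_mul]
        calc |g ρ y| * |ζ y| ≤ 1 * 1 :=
            mul_le_mul (hg1 ρ y) (hζ1 y) (abs_nonneg _) zero_le_one
          _ = 1 := one_mul 1
      have hχ0 : ∀ y ∉ ball x₀ (2 * ρ), g ρ y * ζ y = 0 := fun y hy => by
        have : g ρ y = 0 := fpl_trunc_eq_zero hρ hy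
        rw [this, zero_mul]
      have h4 := fpl_integral_norm_pow_four_le (χ := fun y => g ρ y * ζ y) hw.continuous hχ1
        (c := x₀) (r := 2 * ρ) hχ0 hM
      calc C_N * ∫ y, ‖v ρ y‖ ^ 4 = C_N * ∫ y, ‖(g ρ y * ζ y) • w y‖ ^ 4 := by rfl
        _ ≤ C_N * (M ^ 2 * ∫ y in ball x₀ (2 * ρ), ‖w y‖ ^ 2) := mul_le_mul_of_nonneg_left h4 hCN0
        _ ≤ C_N * (M ^ 2 * (M ^ 2 * ((2 * ρ) ^ 3 * V))) := by
            gcongr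
            exact hwint x₀ (2 * ρ) (by linarith)
        _ = (8 * C_N * M ^ 4 * V) * ρ ^ 3 := by ring
        _ ≤ 9 * P * ρ ^ 3 := by
            apply mul_le_mul_of_nonneg_right _ (pow_nonneg hρ.le 3)
            have hX : 0 ≤ C_N * M ^ 4 * V := mul_nonneg (mul_nonneg hCN0 (pow_nonneg hM0 4)) hV0
            have e8 : 8 * C_N * M ^ 4 * V = 8 * (C_N * M ^ 4 * V) := by ring
            have e9 : 9 * P = 576 * (C_N * M ^ 4 * V) := by rw [hPdef]; ring
            rw [e8, e9]
            linarith
    have hA0 : 0 ≤ L * V := mul_nonneg hL0 hV0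
    have hB0 : 0 ≤ |q x₀| * V + 4 * Real.sqrt (V * P) :=
      add_nonneg (mul_nonneg (abs_nonneg _) hV0) (mul_nonneg (by norm_num) (Real.sqrt_nonneg _))
    refine ⟨L * V, |q x₀| * V + 4 * Real.sqrt (V * P), hA0, hB0, fun ρ hρ => ?_⟩
    have hρ0 : 0 < ρ := by linarith
    have hq_ball : ∀ y ∈ ball x₀ ρ, |q y| ≤ |q x₀| + L * ρ := by
      intro y hy
      have hmv : ‖q y - q x₀‖ ≤ L * ‖y - x₀‖ :=
        (convex_univ).norm_image_sub_le_of_norm_fderiv_le (fun z _ => (hq.differentiable (by simp)) z)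
          (fun z _ => hL z) (mem_univ x₀) (mem_univ y)
      rw [mem_ball, dist_eq_norm] at hy
      rw [Real.norm_eq_abs] at hmv
      have h2 : |q y| ≤ |q x₀| + |q y - q x₀| := by
        have := abs_add_le (q x₀) (q y - q x₀); rwa [add_sub_cancel] at this
      have h3 : L * ‖y - x₀‖ ≤ L * ρ := mul_le_mul_of_nonneg_left hy.le hL0
      linarith
    obtain ⟨hQmem, hQs⟩ := hQsq ρ hρ0
    have key := fpl_L1_ball_bound hq.continuous hp₁d.continuous (hQd ρ hρ0).continuous hp₁mem hQmem
      hρ0 hP0 hq_ball (hp₁sq' ρ hρ) hQs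
    simpa only [hH, Pi.sub_apply] using key
  -- the oscillation of `DH_ρ` between `x` and `x₀` tends to zero
  have hosc : Tendsto (fun ρ => fderiv ℝ (H ρ) x - fderiv ℝ (H ρ) x₀) atTop (𝓝 0) := by
    rw [tendsto_zero_iff_norm_tendsto_zero]
    have hxx₀ : ‖x - x₀‖ < 2 * R := by rwa [mem_ball, dist_eq_norm] at hx
    -- the majorant `K' ‖x - x₀‖ (A/ρ + B/ρ²)`
    have hbound : ∀ᶠ ρ in atTop, ‖fderiv ℝ (H ρ) x - fderiv ℝ (H ρ) x₀‖ ≤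
        K' * ‖x - x₀‖ * (A * ρ⁻¹ + B * (ρ ^ 2)⁻¹) := by
      filter_upwards [eventually_ge_atTop (8 * R)] with ρ hρ
      have hρ0 : 0 < ρ := by linarith
      have hx' : x ∈ ball x₀ (ρ / 4) := by
        rw [mem_ball, dist_eq_norm]; linarith
      have h := hK' (H ρ) (hHd ρ hρ0) x₀ ρ hρ0 (hHharm ρ (by linarith)) x hx'
      refine h.trans ?_
      have hIρ := hI ρ (by linarith)
      have hI0 : 0 ≤ ∫ y in ball x₀ ρ, |H ρ y| := integral_nonneg fun y => abs_nonneg _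
      have hρinv : (ρ ^ 5)⁻¹ * (A * ρ ^ 4 + B * ρ ^ 3) = A * ρ⁻¹ + B * (ρ ^ 2)⁻¹ := by
        field_simp
      calc K' * (ρ ^ 5)⁻¹ * (∫ y in ball x₀ ρ, |H ρ y|) * ‖x - x₀‖
          ≤ K' * (ρ ^ 5)⁻¹ * (A * ρ ^ 4 + B * ρ ^ 3) * ‖x - x₀‖ := by gcongr
        _ = K' * ‖x - x₀‖ * ((ρ ^ 5)⁻¹ * (A * ρ ^ 4 + B * ρ ^ 3)) := by ring
        _ = K' * ‖x - x₀‖ * (A * ρ⁻¹ + B * (ρ ^ 2)⁻¹) := by rw [hρinv]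
    have hlim0 : Tendsto (fun ρ : ℝ => K' * ‖x - x₀‖ * (A * ρ⁻¹ + B * (ρ ^ 2)⁻¹)) atTop (𝓝 0) := by
      have h1 : Tendsto (fun ρ : ℝ => ρ⁻¹) atTop (𝓝 0) := tendsto_inv_atTop_zero
      have h2 : Tendsto (fun ρ : ℝ => (ρ ^ 2)⁻¹) atTop (𝓝 0) :=
        tendsto_inv_atTop_zero.comp (tendsto_pow_atTop two_ne_zero)
      have h3 := ((h1.const_mul A).add (h2.const_mul B)).const_mul (K' * ‖x - x₀‖)
      have h0 : K' * ‖x - x₀‖ * (A * 0 + B * 0) = 0 := by ring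
      rw [h0] at h3
      exact h3
    refine squeeze_zero' (Eventually.of_forall fun ρ => norm_nonneg _) hbound hlim0
  -- identify the limit
  have hDH : ∀ ρ, 8 * R ≤ ρ → fderiv ℝ (H ρ) x - fderiv ℝ (H ρ) x₀ =
      (fderiv ℝ q x - fderiv ℝ p₁ x + ∫ y, Tρ ρ x y) -
        (fderiv ℝ q x₀ - fderiv ℝ p₁ x₀ + ∫ y, Tρ ρ x₀ y) := by
    intro ρ hρ
    have hρ0 : 0 < ρ := by linarith
    have hdq : ∀ z, DifferentiableAt ℝ q z := fun z => (hq.differentiable (by simp)) z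
    have hdp : ∀ z, DifferentiableAt ℝ p₁ z := fun z => (hp₁d.differentiable (by simp)) z
    have hdQ : ∀ z, DifferentiableAt ℝ (Q ρ) z := fun z => ((hQd ρ hρ0).differentiable (by simp)) z
    have e : ∀ z ∈ ball x₀ (2 * R), fderiv ℝ (H ρ) z = fderiv ℝ q z - fderiv ℝ p₁ z + ∫ y, Tρ ρ z y := by
      intro z hz
      rw [hH, fderiv_sub ((hdq z).sub (hdp z)) (hdQ z), fderiv_sub (hdq z) (hdp z), hDQ ρ hρ0 z hz]
      abel
    rw [e x hx, e x₀ hx₀]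
  have hlim2 : Tendsto (fun ρ => fderiv ℝ (H ρ) x - fderiv ℝ (H ρ) x₀) atTop
      (𝓝 ((fderiv ℝ q x - fderiv ℝ p₁ x + ∫ y, T x y) -
        (fderiv ℝ q x₀ - fderiv ℝ p₁ x₀ + ∫ y, T x₀ y))) := by
    have h := ((tendsto_const_nhds (x := fderiv ℝ q x - fderiv ℝ p₁ x)).add (hlim x hx)).sub
      ((tendsto_const_nhds (x := fderiv ℝ q x₀ - fderiv ℝ p₁ x₀)).add (hlim x₀ hx₀))
    refine h.congr' ?_
    filter_upwards [eventually_ge_atTop (8 * R)] with ρ hρ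
    exact (hDH ρ hρ).symm
  have key := tendsto_nhds_unique hlim2 hosc
  exact sub_eq_zero.1 key

/-- Registered form (sub-goal `fpl_sliceDecomp_main` of crux stmt-NavierStokesRegularity-14060): the
local identity `Dq - Dp̃[ηw] + ∫ D³Γ∞(·-y)(·, ζw, ζw)` is constant on `B(x₀, 2R)`. -/
theorem fpl_sliceDecomp_main :
    ∀ (w : EuclideanSpace ℝ (Fin 3) → EuclideanSpace ℝ (Fin 3)), ContDiff ℝ (⊤ : ℕ∞) w →
    Literature.Analysis.FluidPDE.VectorCalculus.IsDivFree w → ∀ (M : ℝ), (∀ y, ‖w y‖ ≤ M) →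
    ∀ (q : EuclideanSpace ℝ (Fin 3) → ℝ), ContDiff ℝ (⊤ : ℕ∞) q → ∀ (L : ℝ), (∀ x, ‖fderiv ℝ q x‖ ≤ L) →
    (∀ x, Laplacian.laplacian q x =
      -Literature.Analysis.FluidPDE.VectorCalculus.divergence
        (Literature.Analysis.FluidPDE.convect w w) x) →
    ∀ (x₀ : EuclideanSpace ℝ (Fin 3)) (R : ℝ), 1 ≤ R → ∀ (η ζ : EuclideanSpace ℝ (Fin 3) → ℝ),
    ContDiff ℝ (⊤ : ℕ∞) η → ContDiff ℝ (⊤ : ℕ∞) ζ → (∀ y, η y ^ 2 + ζ y ^ 2 = 1) →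
    (∀ y ∉ Metric.ball x₀ (4 * R), η y = 0) → (∀ y ∈ Metric.ball x₀ (3 * R), ζ y = 0) →
    ∀ x ∈ Metric.ball x₀ (2 * R),
    fderiv ℝ q x - fderiv ℝ (Literature.Analysis.FluidPDE.normalisedPressure fun y => η y • w y) x +
        ∫ y, (Literature.Analysis.FluidPDE.evalDiag (ζ y • w y)).comp
          (fderiv ℝ (fderiv ℝ (fderiv ℝ (Literature.Analysis.FluidPDE.newtonFar (R / 2) R))) (x - y)) =
      fderiv ℝ q x₀ - fderiv ℝ (Literature.Analysis.FluidPDE.normalisedPressure fun y => η y • w y) x₀ +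
        ∫ y, (Literature.Analysis.FluidPDE.evalDiag (ζ y • w y)).comp
          (fderiv ℝ (fderiv ℝ (fderiv ℝ (Literature.Analysis.FluidPDE.newtonFar (R / 2) R))) (x₀ - y)) :=
  fun _ hw hdiv _ hM _ hq _ hL hΔq _ _ hR _ _ hη hζ h1 hη0 hζ0 _ hx =>
    fpl_slice_identity hw hdiv hM hq hL hΔq hR hη hζ h1 hη0 hζ0 hx

end Summit.NavierStokesRegularity.NavierStokesRegularity.Theorems

end
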